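import Summits.AtomisticToContinuum.BoseEinsteinCondensation.Theses.BECStronglyRayleigh

/-!
# Line `muffin-tin-reward-supermodularity` — skeleton for the crux `BECStronglyRayleigh.LatticeToPeriodicBridge`
(crux item stmt-AtomisticToContinuum-9674, rank 4, route `route-AtomisticToContinuum-BECStronglyRayleigh`)

Crux (FIXED, by name): `LatticeToPeriodicBridge := KineticLatticeBEC → PeriodicBEC` — uniform RP-free BEC of
hard-core lattice bosons on the even tori `(ℤ/Mℤ)³` at every filling `≤ ½` (the antecedent `A`, = the route's
rank-0 target) implies torus BEC of the dilute continuum gas: for every repulsive finite-range `v`, `∃ρ₀ ∀ρ<ρ₀ ∃c>0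
∀ᶠN ∃δ>0`, every periodic `δ`-near-minimiser on the torus of side `L_N = (N/ρ)^{1/3}` has constant-mode
occupation `≥ cN`.

Idea (card `Ideas/muffin-tin-reward-supermodularity.md`, crux-ideate r1 ideator 3; triage r1-1/2/3: pass, pass,
pass): a THICK flat-walled muffin-tin wall potential `λ·W`, `W(X) = Σᵢ Σ_k 1{fract(M x_{i,k}/L) < w}` (period
`b = L/M`, relative wall thickness `w`, cubic wells of side `ℓ = (1-w)b`), is the one deformation of `-Δ + Σv`
whose `λ → ∞` limit at FIXED `(N, L)` is literally the antecedent's model (thick walls `wb > 2R₀(v)` ⇒ the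
interaction through a wall, `≍ e^{-2√λ(wb-R₀)}`, loses to the tunnelling `≍ e^{-√λ·wb}` — planner's sharpening of
the card's `wb ≥ R₀`; fixed in-well pair cost against vanishing hopping ⇒ exact hard core) and whose deep Bloch
function keeps the `λ`-INDEPENDENT share `z_w = ((8/π²)(1-w))³ > 0` of the constant mode (periodised Dirichlet
sine, not a shrinking Gaussian) — so the anchor is a fixed-`N` limit read at lattice size `M = M_N` and filling
`≤ 1/16` for EVERY `N` (no sparse sequence), and the bridge is ONE SIGN: the constant-mode occupation does not
increase with the wall height ("walls only deplete", LDM₀). The card's tool for the sign is the exact Maxwell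
relation `∂_λ n₀ = -∂_κ⟨W⟩` of the jointly concave two-coupling energy `E(λ,κ) = inf(H + λW + κ(N - n̂₀))`:
LDM₀ is the `κ = 0⁺` germ of supermodularity of `E` (typed below as the unregistered tools `RewardWallGerm`,
`MaxwellDanskin`).

THE PLANNER'S CUT (what makes the composition kernel-checkable and moves every uniqueness/gap question to the
wall-free end): every statement is about the UPPER ground-state occupation
`n₀⁺(λ,κ) = ⨅_{δ>0} ⨆ {n₀(Ψ) : Ψ a δ-near-minimiser of E + λW + κ(N-n₀)}` (`upperCondensate`), the largest
constant-mode occupation among asymptotic ground states — for which `∂⁺_κ E(λ,0) = N - n₀⁺(λ,0)` holds with NO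
spectral hypothesis (Danskin), so LDM₀ for `n₀⁺` is EXACTLY the Maxwell germ; the anchor bounds `n₀⁺` from below
(needs no uniqueness along the dial either); and the passage from `n₀⁺(0,0)` to "EVERY near-minimiser" (what the
consequent asks) is made only at `λ = κ = 0`, by the fixed-`N` rigidity of the wall-free torus gas that every torus
route of the sub-problem needs anyway (stmt-9467 + stmt-9164).

THE LINE (4 registered stubs, glued by `LatticeToPeriodicBridge_of`):
* `stub_wallsOnlyDeplete` (S1, HARDEST — the sign): `n₀⁺(λ,0) ≤ n₀⁺(0,0)` for `λ ≥ 0`, in the typed geometry only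
  (`M ≥ 2`, `L ≥ b₁(v,w)·M` i.e. thick walls, density `N ≤ ρ₁(v,w)L³`; triage r1-2/r1-3 sharpenings (1)(2)).
* `stub_deepWallBand` (S2, XL→L — the fixed-`N` strong-confinement limit): for every normalised sector-`N` ground
  vector `ψ` of the hard-core hopping model `xyTorus 3 M 1`, `liminf_{λ→∞} n₀⁺(λ,0) ≥ z_w · cohSum(ψ)/M³`, where
  `cohSum ψ N = Σ_{|T|=N-1} |Σ_{x∉T} ψ(1_{T∪{x}})|² = ⟨ψ, S⁺_tot S⁻_tot ψ⟩`.
* `stub_latticeReadout` (S3, M, provable now; takes `SectorGroundStatePerron` (stmt-9677) and `PenaltySelectsSector`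
  (stmt-9678) BY NAME): the antecedent's penalised tracial bracket equals (here: is at most) `cohSum ψ N` for a
  normalised sector ground vector `ψ`, which exists.
* `stub_freeEndRigidity` (S4, M given stmt-9467 + stmt-9164): at `λ = κ = 0`, low density, `∀ε ∀ᶠN ∃δ`, any two
  `δ`-near-minimisers of the periodic energy on `L_N` have constant-mode occupations within `εN`.
* `LatticeToPeriodicBridge_of` — kernel-checked composition (no `sorry` of its own): lattice size
  `M_N = 2⌊L_N/(2B)⌋₊` (`B = max b₀ b₁`), `ρ₀ = min(ρ₁, ρ₂, 1/(16B³))`; `A` at `(M_N, N)` (even, `≥ L₀`, filling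
  `≤ 1/16`) + S3 + S2 ⇒ `ofReal(z c N) ≤ liminf_λ n₀⁺(λ,0)`; S1 ⇒ `≤ n₀⁺(0,0)`; unfolding `n₀⁺(0,0)` at the rigidity
  window `δ` of S4 gives a `δ`-near-minimiser with `n₀ > zcN/2`, hence (S4, `ε = zc/4`) EVERY `δ`-near-minimiser has
  `n₀ ≥ zcN/8`: the consequent with `c' = z c/8`, `z = z_{1/2} = (4/π²)³`.

Disproof.lean (gen 2, read at plan time) honoured: §1/§2/§5 (`not_crux_iff`, `crux_iff_without_of_kinetic`,
`crux_of_diluteBridge`) — `A` is CONSUMED, once per `N`, at `(M_N, N)` with filling `≤ 1/16` (as `A_{1/16}`), and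
nothing else anchors the chain; §3 — consistent at `v = 0` (free lattice bosons: deep `n₀ → z_w N ≥ z_w·bracket/M³`);
§4 + landed `Negative/WindowedBridge` — NO energy window anywhere: the consequent's `δ` is S4's rigidity window,
chosen after `(N, L)`; §6 "(α) order parameter must be `λ_max`, `n₀` dies in a deep lattice" — answered by the flat
thick walls (`z_w > 0`, S2), "(β) comparison sign, Hellmann–Feynman gives nothing on γ" — answered by Danskin for
`n₀⁺` (`MaxwellDanskin`) and isolated as S1; §7 + landed `Negative/UniformThreshold` — `ρ₀` depends on `v` through
`b₀, b₁, ρ₁, ρ₂`; §8c — S1 is typed for `L = M·b` only (no incommensurate corner); §9's standing recommendation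
("file LDM₀ as the attackable stub") is S1. No stub is an instance of a landed `Negative/*` lemma (those refute
windowed / `v`-uniform bridges and card 1's near-minimiser signature lemma). `ledger negatives` (12): none on wall
dials. No `_false_without_` theorem exists for this crux (verdict RESISTS).
-/

noncomputable section

namespace Summit.AtomisticToContinuum.BoseEinsteinCondensation.Cruxes.LatticeToPeriodicBridge.MuffinTinRewardSupermodularity

open MeasureTheory Filter
open scoped ENNReal NNReal BigOperators Topology
open Literature.MathematicalPhysics.QuantumManyBody.BoseGas
open Literature.MathematicalPhysics.QuantumLattice
open Literature.Probability.LatticeModels (TorusSite)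
open Summit.AtomisticToContinuum.BoseEinsteinCondensation.Theses.BECStronglyRayleigh

set_option linter.unusedVariables false

/-! ## Objects — the thick muffin tin and the two-coupling family at fixed `(N, L)` -/

/-- The muffin-tin WALL COUNT of a configuration (slab-sum form, triage r1-2 (3)): the number of pairs
(particle `i`, axis `k`) whose coordinate lies in a wall slab, `fract(M·x_{i,k}/L) < w`. Period `b = L/M`,
relative wall thickness `w ∈ (0,1)`; the wells are the cubes `{fract(M x_k/L) ≥ w ∀k}` of side `ℓ = (1-w)L/M`.
Bounded by `3N`. [folklore] -/
def wallCount {N : ℕ} (M : ℕ) (L w : ℝ) (X : Config N) : ℝ≥0∞ :=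
  ∑ i : Fin N, ∑ k : Fin 3, if Int.fract ((M : ℝ) * X i k / L) < w then 1 else 0

/-- The wall energy `⟨Ψ, W Ψ⟩ = ∫_{cell^N} W(X) |Ψ(X)|² dX` of a wave function on the torus of side `L`. [folklore] -/
def wallEnergy (N : ℕ) (L : ℝ) (M : ℕ) (w : ℝ) (Ψ : Config N → ℂ) : ℝ≥0∞ :=
  ∫⁻ X in cellN N L, wallCount M L w X * ((‖Ψ X‖₊ : ℝ≥0∞)) ^ 2

/-- The TWO-COUPLING functional `⟨Ψ, (H + λW + κ(N - n̂₀)) Ψ⟩ = E_v[Ψ] + λ·⟨W⟩_Ψ + κ·(N - n₀(Ψ))` (the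
constant-mode reward written as the modular penalty `κ(N - n̂₀)`, so everything stays in `ℝ≥0∞`; supermodularity
and all derivatives in `κ` are unchanged). [folklore] -/
def twoCouplingFunctional {N : ℕ} {L : ℝ} (v : ℝ → ℝ≥0∞) (M : ℕ) (w lam kap : ℝ)
    (Ψ : PeriodicTrialState N L) : ℝ≥0∞ :=
  periodicEnergy v Ψ + ENNReal.ofReal lam * wallEnergy N L M w Ψ.ψ +
    ENNReal.ofReal kap * ((N : ℝ≥0∞) - condensateOccupation N L Ψ.ψ)

/-- The two-coupling ground-state energy `E_{N,L}(λ,κ) = inf_Ψ ⟨Ψ, (H + λW + κ(N - n̂₀)) Ψ⟩` (jointly concave in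
`(λ, κ)` as an infimum of affine functions). [folklore] -/
def twoCouplingEnergy (v : ℝ → ℝ≥0∞) (N : ℕ) (L : ℝ) (M : ℕ) (w lam kap : ℝ) : ℝ≥0∞ :=
  ⨅ Ψ : PeriodicTrialState N L, twoCouplingFunctional v M w lam kap Ψ

/-- The UPPER ground-state constant-mode occupation `n₀⁺(λ,κ) = inf_{δ>0} sup {n₀(Ψ) : Ψ δ-near-minimiser}`:
the largest constant-mode occupation among asymptotic ground states of `H + λW + κ(N - n̂₀)` (equal to the
ground state's `n₀` when the ground state is unique with a gap; `N - n₀⁺(λ,κ)` is the RIGHT derivative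
`∂⁺_κ E(λ,κ)` of the concave `E(λ,·)`, by Danskin — see `MaxwellDanskin`). [folklore] -/
def upperCondensate (v : ℝ → ℝ≥0∞) (N : ℕ) (L : ℝ) (M : ℕ) (w lam kap : ℝ) : ℝ≥0∞ :=
  ⨅ (δ : ℝ≥0∞) (_ : 0 < δ),
    ⨆ (Ψ : PeriodicTrialState N L)
      (_ : twoCouplingFunctional v M w lam kap Ψ ≤ twoCouplingEnergy v N L M w lam kap + δ),
      condensateOccupation N L Ψ.ψ

/-- The deep-wall constant-mode SHARE `z_w = ((8/π²)(1-w))³`: `M³·|⟨φ₀, u_m⟩|²` for the Dirichlet sine product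
`u_m` of one well of side `ℓ = (1-w)L/M` (`(∫₀^ℓ √(2/ℓ) sin(πt/ℓ) dt)² / (L/M) = (8/π²)(ℓ M/L)` per axis). [folklore] -/
def deepShare (w : ℝ) : ℝ :=
  (8 / Real.pi ^ 2 * (1 - w)) ^ 3

/-- Occupation indicator of a finite set of torus sites as a spin configuration (occupied = up = `Fin`-index `0`,
the convention of the antecedent and of `GroundStateStability`). [folklore] -/
def occInd {M : ℕ} (S : Finset (TorusSite 3 M)) : TensorIndex (TorusSite 3 M) 2 :=
  fun y => if y ∈ S then 0 else 1

/-- The lattice COHERENCE SUM `cohSum ψ N = Σ_{|T| = N-1} |Σ_{x ∉ T} ψ(1_{T ∪ {x}})|²` of a spin-½ vector on the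
torus `(ℤ/M)³`: for `ψ` in the sector of `N` up spins this is `‖S⁻_tot ψ‖² = ⟨ψ, S⁺_tot S⁻_tot ψ⟩ = M³·n_{k=0}`
(`(S⁻_tot ψ)(1_T) = Σ_{x∉T} ψ(1_{T∪{x}})`, spin-½ matrix elements of `S⁻_x` are `1`). [folklore] -/
def cohSum {M : ℕ} [NeZero M] (ψ : TensorIndex (TorusSite 3 M) 2 → ℂ) (N : ℕ) : ℝ :=
  ∑ T ∈ (Finset.univ : Finset (TorusSite 3 M)).powersetCard (N - 1),
    ‖∑ x ∈ Finset.univ \ T, ψ (occInd (insert x T))‖ ^ 2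

/-- The antecedent's bracket at lattice size `M` and particle number `N`: the tracial ground-state expectation of
`(Sˣ_tot)² + (Sʸ_tot)²` in the penalised XY Hamiltonian `xyTorus 3 M 1 + 4M³(Sᶻ_tot + M³/2 - N)²`, plus `N - M³/2`
— VERBATIM the right-hand side of `KineticLatticeBEC` (= `⟨S⁺_tot S⁻_tot⟩` of the sector-`N` ground state). [folklore] -/
def latticeBracket (M : ℕ) [NeZero M] (N : ℕ) : ℝ :=
  ((xyTorus 3 M 1 + (((3 + 1) * M ^ 3 : ℕ) : ℂ) • (totalSpin 1 2 + ((M : ℂ) ^ 3 / 2 - (N : ℂ)) • 1) ^ 2).groundStateFunctional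
      (totalSpin 1 0 * totalSpin 1 0 + totalSpin 1 1 * totalSpin 1 1)).re + N - (M : ℝ) ^ 3 / 2

/-- A normalised ground vector of the hard-core hopping model `xyTorus 3 M 1` in the sector of `N` particles
(`Sᶻ_tot = N - M³/2`), written with the clauses of `SectorGroundStatePerron`. [folklore] -/
def IsSectorGround (M : ℕ) [NeZero M] (N : ℕ) (ψ : TensorIndex (TorusSite 3 M) 2 → ℂ) : Prop :=
  ψ ∈ spinZSector 1 ((N : ℝ) - (M : ℝ) ^ 3 / 2) ∧
    (xyTorus 3 M 1).mulVec ψ = ((lowestEnergyInSector 1 (xyTorus 3 M 1) ((N : ℝ) - (M : ℝ) ^ 3 / 2) : ℝ) : ℂ) • ψ ∧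
    ∑ σ, ‖ψ σ‖ ^ 2 = 1

/-! ## The four stub statements -/

/-- **S1 — walls only deplete (LDM₀, upper-occupation endpoint form; the SIGN, hardest).** For every admissible `v`
and wall fraction `w ∈ (0,1)` there are a thick-wall threshold `b₁` and a density cap `ρ₁` such that on every torus
`L ≥ b₁ M` carrying the `M`-periodic muffin tin (`M ≥ 2`) with `N ≤ ρ₁ L³` particles, raising the walls from `0` to
any height `λ ≥ 0` does not increase the upper ground-state constant-mode occupation: `n₀⁺(λ,0) ≤ n₀⁺(0,0)`. -/
def WallsOnlyDeplete : Prop :=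
  ∀ v : ℝ → ℝ≥0∞, IsRepulsiveFiniteRange v → ∀ w : ℝ, 0 < w → w < 1 →
    ∃ b₁ : ℝ, 0 < b₁ ∧ ∃ ρ₁ : ℝ, 0 < ρ₁ ∧
      ∀ M : ℕ, 2 ≤ M → ∀ L : ℝ, b₁ * M ≤ L → ∀ N : ℕ, (N : ℝ) ≤ ρ₁ * L ^ 3 →
        ∀ lam : ℝ, 0 ≤ lam →
          upperCondensate v N L M w lam 0 ≤ upperCondensate v N L M w 0 0

/-- **S2 — the deep-wall band (fixed-`N` strong-confinement limit).** For every admissible `v` and `w ∈ (0,1)` there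
is a thick-wall threshold `b₀` (`> 2R₀(v)/w`) such that for `M ≥ 2`, `L ≥ b₀ M`, `1 ≤ N ≤ M³` and EVERY normalised
sector-`N` ground vector `ψ` of `xyTorus 3 M 1`:
`ofReal(z_w · cohSum(ψ)/M³) ≤ liminf_{λ→∞} n₀⁺(λ,0)`. -/
def DeepWallBand : Prop :=
  ∀ v : ℝ → ℝ≥0∞, IsRepulsiveFiniteRange v → ∀ w : ℝ, 0 < w → w < 1 →
    ∃ b₀ : ℝ, 0 < b₀ ∧
      ∀ (M : ℕ) [NeZero M], 2 ≤ M → ∀ L : ℝ, b₀ * M ≤ L → ∀ N : ℕ, 1 ≤ N → N ≤ M ^ 3 →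
        ∀ ψ : TensorIndex (TorusSite 3 M) 2 → ℂ, IsSectorGround M N ψ →
          ENNReal.ofReal (deepShare w / (M : ℝ) ^ 3 * cohSum ψ N) ≤
            Filter.liminf (fun lam : ℝ => upperCondensate v N L M w lam 0) Filter.atTop

/-- **S3 — lattice readout (finite-dimensional; provable now from two supports of the route, taken BY NAME).**
Given sector Perron–Frobenius (`SectorGroundStatePerron`, stmt-9677) and the penalty encoding
(`PenaltySelectsSector`, stmt-9678): for `M ≥ 2` and `1 ≤ N ≤ M³` there is a normalised sector-`N` ground vector
`ψ` of `xyTorus 3 M 1` with `latticeBracket M N ≤ cohSum ψ N` (in fact equality: the penalised ground space is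
`ℂψ`, the tracial functional is `⟨ψ, · ψ⟩`, and `(Sˣ)²+(Sʸ)² = S⁺S⁻ - Sᶻ` with `Sᶻ_tot = N - M³/2` on the sector). -/
def LatticeReadout : Prop :=
  SectorGroundStatePerron → PenaltySelectsSector →
    ∀ (M : ℕ) [NeZero M], 2 ≤ M → ∀ N : ℕ, 1 ≤ N → N ≤ M ^ 3 →
      ∃ ψ : TensorIndex (TorusSite 3 M) 2 → ℂ, IsSectorGround M N ψ ∧ latticeBracket M N ≤ cohSum ψ N

/-- **S4 — rigidity of the constant-mode occupation at the wall-free end (`λ = κ = 0`).** For every admissible `v`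
there is `ρ₂ > 0` such that for `0 < ρ < ρ₂`, every `ε > 0`, eventually in `N`, some window `δ > 0` makes the
constant-mode occupations of any two `δ`-near-minimisers of the periodic energy on the torus of side `L_N` agree up
to `εN`. (Corollary of PeriodicRigidity stmt-9467 — near-minimisers are `L²`-close modulo phase — and
PeriodicOccupationStability stmt-9164 — `√n₀` is `√N`-Lipschitz in `L²(cell^N)`; the only place where uniqueness /
a gap of a torus ground state enters the line, and only for the physical, wall-free gas.) -/
def FreeEndRigidity : Prop :=
  ∀ v : ℝ → ℝ≥0∞, IsRepulsiveFiniteRange v →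
    ∃ ρ₂ : ℝ, 0 < ρ₂ ∧ ∀ ρ : ℝ, 0 < ρ → ρ < ρ₂ → ∀ ε : ℝ, 0 < ε →
      ∀ᶠ N : ℕ in Filter.atTop, ∃ δ : ℝ≥0∞, 0 < δ ∧
        ∀ Ψ Φ : PeriodicTrialState N (sideLength ρ N),
          periodicEnergy v Ψ ≤ periodicGroundStateEnergy v N (sideLength ρ N) + δ →
          periodicEnergy v Φ ≤ periodicGroundStateEnergy v N (sideLength ρ N) + δ →
            condensateOccupation N (sideLength ρ N) Ψ.ψ ≤
              condensateOccupation N (sideLength ρ N) Φ.ψ + ENNReal.ofReal (ε * N)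

/-! ## The card's TOOLS for S1, typed but NOT registered (no obligation; recorded so the lead and the disprover
attack the same statements). `RewardWallGerm` is the `κ = 0⁺` germ of supermodularity of `E(λ,κ)` with an `o(κ)`
defect allowed; `MaxwellDanskin` (provable now, pure variational analysis in `ℝ≥0∞`: `∂⁺_κ E(λ,0) = N - n₀⁺(λ,0)`
from the two Danskin inequalities `E(λ,κ) ≤ E(λ,0) + δ + κ(N - n₀Ψ)` for `δ`-near-minimisers `Ψ` at `κ = 0`, and
`E(λ,κ) ≥ E(λ,0) + κ(N - sup{n₀Φ : Φ (κN+ε)-near-min at κ = 0}) - ε`) says the germ at `(λ₁, λ₂)` is EQUIVALENT to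
`n₀⁺(λ₂,0) ≤ n₀⁺(λ₁,0)`; so S1 = the germ at `λ₁ = 0`, and strip supermodularity (ED: 1953/1953 minors `> 0`,
j008682) or the path-space covariance `Cov(∫n̂₀, ∫W) ≥ 0` are sufficient conditions. -/

/-- The Maxwell/supermodularity GERM at the reward-free edge, with `o(κ)` slack: for `0 ≤ λ₁ ≤ λ₂` and `ε > 0` there
is `κ₀ > 0` with `E(λ₂,0) + E(λ₁,κ) ≤ E(λ₂,κ) + E(λ₁,0) + εκ` for `0 ≤ κ ≤ κ₀` ("an infinitesimal condensate reward
pushes particles onto the walls": `∂_κ⟨W⟩ ≥ 0 ⟺ ∂_λ n₀ ≤ 0`). Typed geometry as in S1. [folklore] -/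
def RewardWallGerm : Prop :=
  ∀ v : ℝ → ℝ≥0∞, IsRepulsiveFiniteRange v → ∀ w : ℝ, 0 < w → w < 1 →
    ∃ b₁ : ℝ, 0 < b₁ ∧ ∃ ρ₁ : ℝ, 0 < ρ₁ ∧
      ∀ M : ℕ, 2 ≤ M → ∀ L : ℝ, b₁ * M ≤ L → ∀ N : ℕ, (N : ℝ) ≤ ρ₁ * L ^ 3 →
        ∀ lam₁ lam₂ : ℝ, 0 ≤ lam₁ → lam₁ ≤ lam₂ → ∀ ε : ℝ, 0 < ε → ∃ κ₀ : ℝ, 0 < κ₀ ∧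
          ∀ kap : ℝ, 0 ≤ kap → kap ≤ κ₀ →
            twoCouplingEnergy v N L M w lam₂ 0 + twoCouplingEnergy v N L M w lam₁ kap ≤
              twoCouplingEnergy v N L M w lam₂ kap + twoCouplingEnergy v N L M w lam₁ 0 + ENNReal.ofReal (ε * kap)

/-- DANSKIN ⇒ MAXWELL: at fixed `(v, N, L, M, w)` and `0 ≤ λ₁ ≤ λ₂`, the germ inequality (for every `ε`, on some
`[0, κ₀(ε)]`) implies `n₀⁺(λ₂,0) ≤ n₀⁺(λ₁,0)` (and conversely). Provable now; junk-robust (`E ≡ ⊤` gives equality,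
`L ≤ 0` gives `0 ≤ 0`). With `RewardWallGerm` it yields `WallsOnlyDeplete`. [folklore] -/
def MaxwellDanskin : Prop :=
  ∀ (v : ℝ → ℝ≥0∞) (N : ℕ) (L : ℝ) (M : ℕ) (w lam₁ lam₂ : ℝ), 0 ≤ lam₁ → lam₁ ≤ lam₂ →
    (∀ ε : ℝ, 0 < ε → ∃ κ₀ : ℝ, 0 < κ₀ ∧ ∀ kap : ℝ, 0 ≤ kap → kap ≤ κ₀ →
      twoCouplingEnergy v N L M w lam₂ 0 + twoCouplingEnergy v N L M w lam₁ kap ≤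
        twoCouplingEnergy v N L M w lam₂ kap + twoCouplingEnergy v N L M w lam₁ 0 + ENNReal.ofReal (ε * kap)) →
    upperCondensate v N L M w lam₂ 0 ≤ upperCondensate v N L M w lam₁ 0

/-! ## Registered stubs -/

/-- **S1 `stub_wallsOnlyDeplete`** (HARDEST; the line's bet). Why plausibly true: (i) `v = 0` / `N = 1`: one-body
statement `m(λ) = (∫u_λ)²/(L³∫u_λ²)` non-increasing for the ground state of `-Δ + λ·W₁` — `f′(0) = 0` by translation
invariance, second order `-λ²‖R Q W φ₀‖² < 0`, deep limit `↘ z_w` from above; 0 violations in 31 + 18 + 31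
continuum geometries (triage r1-1 gen 1/2, r1-3) incl. incommensurate ones not even claimed here; (ii) interacting
ED caricatures: ideator j008682 (31 cases, `d = 1,2,3`, `N ≤ 4`, 1953 grid cells: 0 increases of `n₀` in `λ`, every
supermodularity minor `> 0`), triage r1-3 (finer cells, `k ≤ 8`, irregular wells, 3-D typed geometry `(ℤ/4)³`,
`(ℤ/6)³`: 0/56 violations); (iii) an `O(1)` mean-field driver: a density modulation of relative amplitude `η` costs
the constant mode `η²/8` per particle (`n₀/N ≤ (L⁻³∫√(ρ₁/ρ))²`); (iv) for the UPPER occupation the statement is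
exactly the Maxwell germ (`MaxwellDanskin`), attackable through supermodularity of `E(λ,κ)` on a strip, Legendre-dual
submodularity of the bi-constrained energy, or `Cov_path(∫n̂₀dt, ∫W dt) ≥ 0` in the positive imaginary-time measure.
Honest difficulty: a sign in the regime `L ≫ ξ` that no asymptotic expansion reaches; no correlation-inequality tool
in print. Size: XL (open). -/
theorem stub_wallsOnlyDeplete : WallsOnlyDeplete := by
  sorry

/-- **S2 `stub_deepWallBand`.** Why plausibly true: thick walls (`s = wL/M ≥ b₀w > 2R₀(v)`) make every inter-well
effect of `Σv^{per}` (interaction or hard-core avoidance THROUGH a wall, `≍ e^{-2√λ(s-R₀)}`) negligible against the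
tunnelling amplitude `t_λ ≍ e^{-√λ s}`; the one-body problem SEPARATES into three 1-D Kronig–Penney problems with
rectangular barriers (exactly solvable band: width `≍ t_λ`, gap to the second band `→ 3π²/ℓ²`, lowest Bloch function →
periodised Dirichlet sine of the well, `|⟨φ₀,u₀^λ⟩|² → z_w`); at fixed `(N, M)` the band subspace (`N` bosons in the
lowest band) is finite-dimensional and a Feshbach–Schur reduction with the in-well pair cost `U_well(v,ℓ) ∈ (0,∞]`
FIXED against `t_λ → 0` gives `H_eff = Nε₀(λ) + t_λ·(H_XY + o(1))` on hard-core configurations (double occupancy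
and inter-well tails are `O(t_λ²/U)`, `O(t_λ²)`); the sector ground state of `H_XY` on the connected torus graph is
unique (Perron), so the lowest-band amplitude of any asymptotic ground state converges to `ψ` and its constant-mode
occupation to `(z_w/M³)·⟨ψ, S⁺_totS⁻_totψ⟩ = z_w·cohSum(ψ)/M³` (one-body density matrix of a permanent state with
orthonormal orbitals `u_m`, `⟨φ₀,u_m⟩ = √z_w M^{-3/2}` for all `m`); `n₀⁺ ≥ n₀` of that state. Degenerate ends are
consistent: `v = 0` a.e. gives free lattice bosons, `n₀ → z_w N ≥ z_w cohSum/M³` (as `cohSum = M³ n_{k=0} ≤ M³N`);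
`N = M³` gives the Mott state, equality `z_w`. ED (j008682 (D), triage r1-3): deep values approach `z_u·n₀^{XY}`
from above (`0.269` vs `0.253`; `0.102` vs `0.090`). In print only for two wells (RougerieSpehner2018,
doi:10.1007/s00220-018-3156-2) and one body (Helffer–Sjöstrand 1984); here the separable rectangular barrier and the
thick walls remove the WKB and interaction-tail estimates. Size: L–XL. -/
theorem stub_deepWallBand : DeepWallBand := by
  sorry

/-- **S3 `stub_latticeReadout`.** Why true: by `PenaltySelectsSector` every ground vector of the penalised
Hamiltonian `H_pen = xyTorus 3 M 1 + 4M³(Sᶻ_tot + M³/2 - N)²` lies in the sector `Sᶻ_tot = N - M³/2`, where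
`H_pen = H_XY`; so `groundSpace H_pen` = the sector ground space = `ℂψ₀` (`SectorGroundStatePerron`: a nonzero
entrywise-nonnegative sector ground vector `ψ₀`, unique up to scalars); hence `groundProj = |ψ⟩⟨ψ|` for
`ψ = ψ₀/‖ψ₀‖`, `groundStateFunctional O = ⟨ψ, Oψ⟩`, and
`⟨ψ,((Sˣ_tot)²+(Sʸ_tot)²)ψ⟩ + N - M³/2 = ⟨ψ, S⁺_totS⁻_totψ⟩ - ⟨ψ,Sᶻ_totψ⟩ + N - M³/2 = ‖S⁻_totψ‖² = cohSum ψ N`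
(`[Sˣ,Sʸ] = iSᶻ`; `(S⁻_totψ)(1_T) = Σ_{x∉T}ψ(1_{T∪{x}})`, checked numerically in the tree's conventions by triage
r1-1 gen 2, `card4_identity.py`, to `1e-13`). Equality holds; `≤` is what the line consumes. Size: M (finite-dimensional
linear algebra over `Matrix.groundStateFunctional` / `groundProj` / `spinZSector`; cf. the route's provable-now
supports 9676–9678). -/
theorem stub_latticeReadout : LatticeReadout := by
  sorry

/-- **S4 `stub_freeEndRigidity`.** Why plausibly true: for `ρ < ρ₂(v)` and `N` large, `E₀^{per}(v, N, L_N) < ⊤`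
(finite range, separated bumps; tree `exists_eventually_periodicGroundStateEnergy_lt_top`), the torus Hamiltonian at
fixed `(N, L)` has compact resolvent, a unique positive ground state and a gap (bounded `v`: Reed–Simon XIII.47; hard
cores: low-density connectivity of the torus hard-sphere configuration space, BaryshnikovBubenikKahle2013), so
`δ`-near-minimisers are `L²`-close modulo a phase (= PeriodicRigidity, stmt-9467, typed in four torus routes) and
`√n₀(Ψ) ≤ √n₀(Φ) + √N‖Ψ - cΦ‖` (= PeriodicOccupationStability, stmt-9164, provable now); with `η = ε²/4`:
`n₀Ψ ≤ (√n₀Φ + ε√N/2)² ≤ n₀Φ + εN` (`n₀ ≤ N`). One page from the two items by name; M–L from scratch. Size: M. -/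
theorem stub_freeEndRigidity : FreeEndRigidity := by
  sorry

/-! ## Registered-stub aliases (device of `Lines/six-vertex-euler-gates.lean`): `Registered.stub_X` is the statement
of `stub_X` under the stub's short name, so that the hypotheses of `LatticeToPeriodicBridge_of` are keyed BY NAME
to the registered stubs. -/
namespace Registered

/-- Statement of `stub_wallsOnlyDeplete`. -/
abbrev stub_wallsOnlyDeplete : Prop := WallsOnlyDeplete
/-- Statement of `stub_deepWallBand`. -/
abbrev stub_deepWallBand : Prop := DeepWallBand
/-- Statement of `stub_latticeReadout`. -/
abbrev stub_latticeReadout : Prop := LatticeReadout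
/-- Statement of `stub_freeEndRigidity`. -/
abbrev stub_freeEndRigidity : Prop := FreeEndRigidity

end Registered

/-! ## Proved glue -/

section Glue

/-- At `λ = κ = 0` the two-coupling functional is the periodic energy. [folklore] -/
theorem twoCouplingFunctional_zero_zero {N : ℕ} {L : ℝ} (v : ℝ → ℝ≥0∞) (M : ℕ) (w : ℝ)
    (Ψ : PeriodicTrialState N L) : twoCouplingFunctional v M w 0 0 Ψ = periodicEnergy v Ψ := by
  simp [twoCouplingFunctional]

/-- At `λ = κ = 0` the two-coupling energy is the periodic ground-state energy. [folklore] -/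
theorem twoCouplingEnergy_zero_zero (v : ℝ → ℝ≥0∞) (N : ℕ) (L : ℝ) (M : ℕ) (w : ℝ) :
    twoCouplingEnergy v N L M w 0 0 = periodicGroundStateEnergy v N L := by
  unfold twoCouplingEnergy periodicGroundStateEnergy
  exact iInf_congr fun Ψ => twoCouplingFunctional_zero_zero v M w Ψ

/-- Unfolding `n₀⁺(0,0)` at ONE window: if `a < n₀⁺(0,0)` then for every `δ > 0` some `δ`-near-minimiser of the
periodic energy has constant-mode occupation `> a`. [folklore] -/
theorem exists_nearMin_of_lt_upperCondensate {v : ℝ → ℝ≥0∞} {N : ℕ} {L : ℝ} {M : ℕ} {w : ℝ} {a : ℝ≥0∞}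
    (ha : a < upperCondensate v N L M w 0 0) {δ : ℝ≥0∞} (hδ : 0 < δ) :
    ∃ Φ : PeriodicTrialState N L, periodicEnergy v Φ ≤ periodicGroundStateEnergy v N L + δ ∧
      a < condensateOccupation N L Φ.ψ := by
  have h1 : a < ⨆ (Ψ : PeriodicTrialState N L)
      (_ : twoCouplingFunctional v M w 0 0 Ψ ≤ twoCouplingEnergy v N L M w 0 0 + δ),
      condensateOccupation N L Ψ.ψ :=
    lt_of_lt_of_le ha (iInf₂_le δ hδ)
  rw [lt_iSup_iff] at h1
  obtain ⟨Φ, hΦ⟩ := h1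
  rw [lt_iSup_iff] at hΦ
  obtain ⟨hnear, hlt⟩ := hΦ
  refine ⟨Φ, ?_, hlt⟩
  rwa [twoCouplingFunctional_zero_zero, twoCouplingEnergy_zero_zero] at hnear

/-- `L_N³ = N/ρ`. [folklore] -/
theorem sideLength_cube {ρ : ℝ} (hρ : 0 < ρ) (N : ℕ) : sideLength ρ N ^ 3 = N / ρ := by
  have h : (0 : ℝ) ≤ N / ρ := div_nonneg N.cast_nonneg hρ.le
  rw [sideLength, show (1 / 3 : ℝ) = ((3 : ℕ) : ℝ)⁻¹ by norm_num, Real.rpow_inv_natCast_pow h three_ne_zero]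

/-- `L_N → ∞`. [folklore] -/
theorem sideLength_tendsto {ρ : ℝ} (hρ : 0 < ρ) : Tendsto (fun n : ℕ => sideLength ρ n) atTop atTop :=
  (tendsto_rpow_atTop (by norm_num : (0 : ℝ) < 1 / 3)).comp
    (tendsto_natCast_atTop_atTop.atTop_div_const hρ)

/-- **Lattice-size selection.** For a wall-period floor `B > 0`, a lattice threshold `L₀` and a density
`ρ ≤ 1/(16B³)`, once `L = L_N` is large the even integer `M = 2⌊L/(2B)⌋₊` satisfies `2 ≤ M`, `L₀ ≤ M`, `B·M ≤ L`
(period `b = L/M ≥ B`) and `2N ≤ M³` (filling `≤ ½`; indeed `≤ 1/16`). [folklore] -/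
theorem latticeSize_select {B ρ : ℝ} (hB : 0 < B) (hρ : 0 < ρ) (hρB : ρ ≤ 1 / (16 * B ^ 3)) (L₀ N : ℕ)
    (hL : max (4 * B) (B * (L₀ + 4)) ≤ sideLength ρ N) :
    Even (2 * ⌊sideLength ρ N / (2 * B)⌋₊) ∧ 2 ≤ 2 * ⌊sideLength ρ N / (2 * B)⌋₊ ∧
      L₀ ≤ 2 * ⌊sideLength ρ N / (2 * B)⌋₊ ∧
      B * ((2 * ⌊sideLength ρ N / (2 * B)⌋₊ : ℕ) : ℝ) ≤ sideLength ρ N ∧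
      2 * N ≤ (2 * ⌊sideLength ρ N / (2 * B)⌋₊) ^ 3 := by
  set L := sideLength ρ N with hLdef
  set k : ℕ := ⌊L / (2 * B)⌋₊ with hkdef
  have hL4 : 4 * B ≤ L := (le_max_left _ _).trans hL
  have hLL₀ : B * (L₀ + 4) ≤ L := (le_max_right _ _).trans hL
  have hLpos : 0 < L := lt_of_lt_of_le (by positivity) hL4
  have hy : 0 ≤ L / (2 * B) := by positivity
  have hkle : (k : ℝ) ≤ L / (2 * B) := Nat.floor_le hy
  have hklt : L / (2 * B) < k + 1 := Nat.lt_floor_add_one _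
  have hcast : ((2 * k : ℕ) : ℝ) = 2 * (k : ℝ) := by push_cast; ring
  have hhalfB : 2 * (L / (2 * B)) = L / B := by field_simp
  -- M as a real number, squeezed between L/B - 2 and L/B
  have hMle : ((2 * k : ℕ) : ℝ) ≤ L / B := by
    rw [hcast, ← hhalfB]; linarith
  have hMge : L / B - 2 < ((2 * k : ℕ) : ℝ) := by
    rw [hcast, ← hhalfB]; linarith
  have hLB4 : 4 ≤ L / B := by rw [le_div_iff₀ hB]; linarith
  have hLBL₀ : (L₀ : ℝ) + 4 ≤ L / B := by rw [le_div_iff₀ hB]; linarith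
  refine ⟨even_two_mul k, ?_, ?_, ?_, ?_⟩
  · have h2 : (2 : ℝ) ≤ ((2 * k : ℕ) : ℝ) := by linarith
    exact_mod_cast h2
  · have h2 : (L₀ : ℝ) ≤ ((2 * k : ℕ) : ℝ) := by linarith
    exact_mod_cast h2
  · calc B * ((2 * k : ℕ) : ℝ) ≤ B * (L / B) := mul_le_mul_of_nonneg_left hMle hB.le
      _ = L := by field_simp
  · -- 2N ≤ M³: M ≥ L/B - 2 ≥ L/(2B), so M³ ≥ L³/(8B³) = N/(8ρB³) ≥ 2N
    have hMhalf : L / (2 * B) ≤ ((2 * k : ℕ) : ℝ) := by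
      have h1 : L / (2 * B) ≤ L / B - 2 := by
        rw [← hhalfB]; linarith
      linarith
    have hcube : (L / (2 * B)) ^ 3 ≤ ((2 * k : ℕ) : ℝ) ^ 3 := pow_le_pow_left₀ hy hMhalf 3
    have hL3 : L ^ 3 = N / ρ := sideLength_cube hρ N
    have h16 : ρ * (16 * B ^ 3) ≤ 1 := by
      rwa [le_div_iff₀ (by positivity : (0 : ℝ) < 16 * B ^ 3)] at hρB
    have hkey : (2 * N : ℝ) ≤ (L / (2 * B)) ^ 3 := by
      rw [div_pow, hL3, le_div_iff₀ (by positivity : (0 : ℝ) < (2 * B) ^ 3)]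
      have hrew : (2 * N : ℝ) * (2 * B) ^ 3 = N / ρ * (ρ * (16 * B ^ 3)) := by
        field_simp
        ring
      rw [hrew]
      calc (N : ℝ) / ρ * (ρ * (16 * B ^ 3)) ≤ N / ρ * 1 :=
            mul_le_mul_of_nonneg_left h16 (by positivity)
        _ = N / ρ := mul_one _
    have h2 : (2 * N : ℝ) ≤ ((2 * k : ℕ) : ℝ) ^ 3 := hkey.trans hcube
    exact_mod_cast h2

/-- `ofReal` bookkeeping of the last step: `a/2 < nΦ ≤ nΨ + a/4` gives `a/8 ≤ nΨ` (for `a ≥ 0`). [folklore] -/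
theorem eighth_le_of_half_lt {a : ℝ} (ha : 0 ≤ a) {nΦ nΨ : ℝ≥0∞}
    (h1 : ENNReal.ofReal (a / 2) < nΦ) (h2 : nΦ ≤ nΨ + ENNReal.ofReal (a / 4)) :
    ENNReal.ofReal (a / 8) ≤ nΨ := by
  have h : ENNReal.ofReal (a / 2) ≤ nΨ + ENNReal.ofReal (a / 4) := h1.le.trans h2
  have hsplit : ENNReal.ofReal (a / 2) = ENNReal.ofReal (a / 4) + ENNReal.ofReal (a / 4) := by
    rw [← ENNReal.ofReal_add (by positivity) (by positivity)]; congr 1; ring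
  rw [hsplit] at h
  have h' : ENNReal.ofReal (a / 4) ≤ nΨ := (ENNReal.add_le_add_iff_right ENNReal.ofReal_ne_top).1 h
  exact (ENNReal.ofReal_le_ofReal (by linarith)).trans h'

end Glue

/-! ## The composition: the four stubs (+ the two route supports S3 consumes, by name) give the crux BY NAME -/

/-- **`LatticeToPeriodicBridge` from the line `muffin-tin-reward-supermodularity`** (kernel-checked, no `sorry` of
its own). Fix `w = ½` (`z = z_{1/2} = (4/π²)³`). Given the antecedent `A` (constants `c, L₀`) and an admissible `v`:
thresholds `b₁, ρ₁` (S1), `b₀` (S2), `ρ₂` (S4); `B = max b₀ b₁`, `ρ₀ = min (min ρ₁ ρ₂) (1/(16B³))`, `c' = zc/8`.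
For `ρ < ρ₀` and `N` large (S4's window `δ` at `ε = zc/4`; `L_N ≥ max(4B, B(L₀+4))`): `M = M_N` from
`latticeSize_select`; `A` at `(M, N)` gives `cNM³ ≤ bracket`; S3 gives a sector ground vector `ψ` with
`bracket ≤ cohSum ψ`; S2 gives `ofReal(zcN) ≤ ofReal(z·cohSum/M³) ≤ liminf_λ n₀⁺(λ,0)`; S1 gives
`n₀⁺(λ,0) ≤ n₀⁺(0,0)` for all `λ ≥ 0`, so `ofReal(zcN) ≤ n₀⁺(0,0)`; unfolding `n₀⁺(0,0)` at the window `δ` yields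
a `δ`-near-minimiser `Φ` with `n₀Φ > zcN/2`, and S4 transfers `n₀Ψ ≥ n₀Φ - zcN/4 ≥ zcN/8` to EVERY
`δ`-near-minimiser `Ψ`. -/
theorem LatticeToPeriodicBridge_of (h1 : Registered.stub_wallsOnlyDeplete)
    (h2 : Registered.stub_deepWallBand) (h3 : Registered.stub_latticeReadout)
    (h4 : Registered.stub_freeEndRigidity) (hP : SectorGroundStatePerron) (hQ : PenaltySelectsSector) :
    LatticeToPeriodicBridge := by
  intro hA v hv
  obtain ⟨c, hc, L₀, hlat⟩ := hA
  -- wall fraction ½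
  have hw0 : (0 : ℝ) < 1 / 2 := by norm_num
  have hw1 : (1 / 2 : ℝ) < 1 := by norm_num
  obtain ⟨b₁, hb₁, ρ₁, hρ₁, hLDM⟩ := h1 v hv (1 / 2) hw0 hw1
  obtain ⟨b₀, hb₀, hBand⟩ := h2 v hv (1 / 2) hw0 hw1
  obtain ⟨ρ₂, hρ₂, hRig⟩ := h4 v hv
  set z : ℝ := deepShare (1 / 2) with hz
  have hzpos : 0 < z := by
    rw [hz, deepShare, show (1 : ℝ) - 1 / 2 = 1 / 2 by norm_num]
    positivity
  set B : ℝ := max b₀ b₁ with hBdef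
  have hBpos : 0 < B := lt_max_of_lt_left hb₀
  have hb₀B : b₀ ≤ B := le_max_left _ _
  have hb₁B : b₁ ≤ B := le_max_right _ _
  refine ⟨min (min ρ₁ ρ₂) (1 / (16 * B ^ 3)), lt_min (lt_min hρ₁ hρ₂) (by positivity), ?_⟩
  intro ρ hρ hρlt
  have hρρ₁ : ρ < ρ₁ := hρlt.trans_le ((min_le_left _ _).trans (min_le_left _ _))
  have hρρ₂ : ρ < ρ₂ := hρlt.trans_le ((min_le_left _ _).trans (min_le_right _ _))
  have hρB : ρ ≤ 1 / (16 * B ^ 3) := (hρlt.trans_le (min_le_right _ _)).le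
  have hzc : 0 < z * c := mul_pos hzpos hc
  refine ⟨z * c / 8, by positivity, ?_⟩
  -- eventually in N: the rigidity window (ε = zc/4), N ≥ 1, and L_N large
  have hev := hRig ρ hρ hρρ₂ (z * c / 4) (by positivity)
  filter_upwards [hev, eventually_ge_atTop 1,
    (sideLength_tendsto hρ).eventually_ge_atTop (max (4 * B) (B * (L₀ + 4)))] with N hrigN hN1 hLN
  obtain ⟨δ, hδ, hrig⟩ := hrigN
  -- the lattice size
  obtain ⟨hMeven, hM2, hL₀M, hBM, h2N⟩ := latticeSize_select hBpos hρ hρB L₀ N hLN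
  set L := sideLength ρ N with hLdef
  set M : ℕ := 2 * ⌊L / (2 * B)⌋₊ with hMdef
  refine ⟨δ, hδ, fun Ψ hΨ => ?_⟩
  haveI : NeZero M := ⟨by omega⟩
  have hNM : N ≤ M ^ 3 := (Nat.le_mul_of_pos_left N (by norm_num : 0 < 2)).trans h2N
  have hM0 : (0 : ℝ) < M := by exact_mod_cast (show 0 < M by omega)
  -- the antecedent, consumed at (M, N): c N M³ ≤ bracket
  have hbr : c * N * (M : ℝ) ^ 3 ≤ latticeBracket M N := hlat M hL₀M hMeven N hN1 h2N
  -- S3: a normalised sector ground vector reading the bracket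
  obtain ⟨ψ, hψ, hread⟩ := h3 hP hQ M hM2 N hN1 hNM
  -- S2: the deep-wall band
  have hb₀M : b₀ * M ≤ L := (mul_le_mul_of_nonneg_right hb₀B hM0.le).trans hBM
  have hband := hBand M hM2 L hb₀M N hN1 hNM ψ hψ
  have hzcN : z * c * N ≤ z / (M : ℝ) ^ 3 * cohSum ψ N := by
    have hM3 : (0 : ℝ) < (M : ℝ) ^ 3 := by positivity
    rw [div_mul_eq_mul_div, le_div_iff₀ hM3]
    calc z * c * N * (M : ℝ) ^ 3 = z * (c * N * (M : ℝ) ^ 3) := by ring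
      _ ≤ z * cohSum ψ N := mul_le_mul_of_nonneg_left (hbr.trans hread) hzpos.le
  have hkey : ENNReal.ofReal (z * c * N) ≤
      Filter.liminf (fun lam : ℝ => upperCondensate v N L M (1 / 2) lam 0) Filter.atTop :=
    (ENNReal.ofReal_le_ofReal hzcN).trans hband
  -- S1: walls only deplete, so the liminf is below n₀⁺(0,0)
  have hb₁M : b₁ * M ≤ L := (mul_le_mul_of_nonneg_right hb₁B hM0.le).trans hBM
  have hNρ₁ : (N : ℝ) ≤ ρ₁ * L ^ 3 := by
    rw [hLdef, sideLength_cube hρ N]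
    calc (N : ℝ) = ρ * (N / ρ) := by field_simp
      _ ≤ ρ₁ * (N / ρ) := mul_le_mul_of_nonneg_right hρρ₁.le (by positivity)
  have hldm : ∀ lam : ℝ, 0 ≤ lam →
      upperCondensate v N L M (1 / 2) lam 0 ≤ upperCondensate v N L M (1 / 2) 0 0 :=
    fun lam hlam => hLDM M hM2 L hb₁M N hNρ₁ lam hlam
  have hlim : Filter.liminf (fun lam : ℝ => upperCondensate v N L M (1 / 2) lam 0) Filter.atTop ≤
      upperCondensate v N L M (1 / 2) 0 0 :=
    Filter.liminf_le_of_frequently_le' (((Filter.eventually_ge_atTop (0 : ℝ)).mono hldm).frequently)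
  have hU : ENNReal.ofReal (z * c * N) ≤ upperCondensate v N L M (1 / 2) 0 0 := hkey.trans hlim
  -- unfold n₀⁺(0,0) at S4's window δ: a δ-near-minimiser Φ with n₀ Φ > zcN/2
  have hNpos : 0 < N := hN1
  have hzcN0 : 0 < z * c * N := by positivity
  have hhalf : ENNReal.ofReal (z * c * N / 2) < upperCondensate v N L M (1 / 2) 0 0 := by
    refine lt_of_lt_of_le ?_ hU
    rw [ENNReal.ofReal_lt_ofReal_iff hzcN0]
    linarith
  obtain ⟨Φ, hΦ, hΦocc⟩ := exists_nearMin_of_lt_upperCondensate hhalf hδ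
  -- S4: every δ-near-minimiser Ψ inherits n₀ Ψ ≥ n₀ Φ - zcN/4 ≥ zcN/8
  have htrans := hrig Φ Ψ hΦ hΨ
  rw [show z * c / 4 * (N : ℝ) = z * c * N / 4 by ring] at htrans
  have h8 := eighth_le_of_half_lt hzcN0.le hΦocc htrans
  rwa [show z * c / 8 * (N : ℝ) = z * c * N / 8 by ring]

/-- Wiring check: the registered stubs (and the two route supports, as hypotheses by name) feed
`LatticeToPeriodicBridge_of` as stated. -/
example (hP : SectorGroundStatePerron) (hQ : PenaltySelectsSector) : LatticeToPeriodicBridge :=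
  LatticeToPeriodicBridge_of stub_wallsOnlyDeplete stub_deepWallBand stub_latticeReadout
    stub_freeEndRigidity hP hQ

end Summit.AtomisticToContinuum.BoseEinsteinCondensation.Cruxes.LatticeToPeriodicBridge.MuffinTinRewardSupermodularity

end
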